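import Mathlib
import Literature.Algebra.Polynomial.SelfReciprocalZerosCriterion
import HarnessLib

/-!
# Suzuki's linear-system recursion for `R_n(c)`, genus `g ≤ 2` (Suzuki 2012, §2.1–§2.2)

The companion file `Literature.Algebra.Polynomial.SelfReciprocalZerosCriterion` takes the PRINTED small
table of the rational functions `R_n(c)` (Suzuki, arXiv:1211.2953, §2.2) as the definition for `g ≤ 2`
and proves Theorem 2.6 for it. In the source, however, `R_n` is DEFINED by a linear-system recursion:

> [Suzuki2012SelfReciprocal] §2.1: the `(2k+2) × (2k+2)` matrices `P_k(m_k)` and the `(2k+2) × (2k+4)`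
> matrices `Q_k` (`P₀, Q₀, P₁(m₁), Q₁` displayed; `P_k, Q_k` for `k ≥ 2` blockwise from `V_k^±, W_k^±`),
> Lemma 2.1 (`det P_k(m_k) = ±2^j m_k^{j+1}` for `k = 2j+1`, `±2^j m_k^j` for `k = 2j`), the recursion
> (def_m1) `m_{2g−n} := (v_g(n−1)[1] + v_g(n−1)[2g−n+2]) / (v_g(n−1)[2g−n+3] − v_g(n−1)[4g−2n+4])`,
> (def_v1) `v_g(n) := P_{2g−n}(m_{2g−n})⁻¹ Q_{2g−n} v_g(n−1)`; §2.2: the initial vector (def_v0)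
> `v_g(0) = ᵗ(c₀,…,c_g,…,c₀; c₀ log q^g, …, c_{g−1} log q, 0, −c_{g−1} log q, …, −c₀ log q^g)`, the
> convention (def_mg) `m_{2g} := 1/(g log q)`, (def_R) `R_n := ∏ m_{2g−(2j+1)}/m_{2g−2j}` (`n` odd) /
> `∏ m_{2g−(2j+2)}/m_{2g−(2j+1)}` (`n` even), (rel_mR) `m_{2g−n} = R_{n−1}R_n/(g log q)`, and «for small
> positive integer `g`, we can calculate `R_n(c)` by hand according to the definition … small table».

This file types that recursion AS PRINTED for `k ≤ 3` (all that genus `g ≤ 2` uses) and RUNS it in the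
kernel: `P0 … P3`, `Q0 … Q3` (literal matrices), Lemma 2.1 for `k = 1, 2` (`det_P1`, `det_P2`; for
`k = 3` invertibility is witnessed directly), the explicit inverses `P1inv … P3inv` (`Pk_mul_Pkinv`,
hence `(P_k m)⁻¹ = Pkinv m` for `m ≠ 0`), the quotient
maps (def_m1) `mq3 … mq0`, the steps (def_v1) `step3 … step0` (with Lean's `Matrix` inverse `⁻¹`), and
the chains `GenusOne.v0Rec …`, `GenusTwo.v0Rec, v1Rec, …, v4Rec`, `mRec_k`, `RRec_n`. MAIN THEOREMS:
**`GenusTwo.RRec_eq_table`** — the recursion's `R₁, R₂, R₃, R₄` ARE the printed table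
(`R₁ = 1`, `R₂ = (4c₀+c₁)/(4c₀−c₁)`, `R₃ = (8c₀²−2c₁²+4c₀c₂)/(8c₀²+c₁²−4c₀c₂)`,
`R₄ = (2c₀+2c₁+c₂)/(2c₀−2c₁+c₂)`, i.e. the companion file's `GenusTwo.R₂ R₃ R₄`), **`GenusTwo.mRec_eq_m`**
((rel_mR) for `g = 2`), and `GenusOne.RRec_eq_table`; with the intermediate vectors `v_g(n)` in closed
form (`GenusTwo.v1Rec_eq` … `v4Rec_eq`). The identities are identities of rational functions of
`(c₀, c₁, c₂, L)`, `L = log q`; they are stated on the complement of the divisors where the recursion's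
quotients degenerate (the source's Lemma 2.2: each `m_{2g−n}` is a nonzero rational function), listed as
hypotheses.

Purpose (cell `run/shared/lean/pub/rh-dbr`, COLUMN 6 DBR, LADDER-RH B-D instrument custody): this closes
the last kit-only gap of STEP-0 anchor **P1** for `g ≤ 2` — «lineage A» (the recursion engine, kit
j240121) ≡ the printed table is now a kernel identity for `g ≤ 2` (the closed forms below were first read
off a sympy run, kit j261466, and are VERIFIED here; the kit output is a witness, not a trust input).
RH-FREE: finite linear algebra over `ℝ`; nothing here bears on the Riemann Hypothesis.

## Deliberately NOT here
`P_k, Q_k` for `k ≥ 4` (genus `g ≥ 3`), Lemmas 2.2–2.3 in general (Lemma 2.3's block formula for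
`P_k⁻¹Q_k` is implicit in `Pkinv`), the `q^ω` variant (2.3), and §§3–8.
-/

noncomputable section

namespace Literature.Algebra.Polynomial

namespace SuzukiSelfReciprocal

open Matrix

/-! ## §2.1: the matrices `P_k(m_k)`, `Q_k` for `k ≤ 3`, Lemma 2.1, and their inverses -/

/-- `P₀ = I₂`. [cite: Suzuki2012SelfReciprocal, §2.1 (display of P₀)] -/
def P0 : Matrix (Fin 2) (Fin 2) ℝ :=
  !![1, 0;
     0, 1]

/-- `Q₀ = [[1, 1, 0, 0], [0, 0, 1, −1]]`. [cite: Suzuki2012SelfReciprocal, §2.1 (display of Q₀)] -/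
def Q0 : Matrix (Fin 2) (Fin 4) ℝ :=
  !![1, 1, 0, 0;
     0, 0, 1, -1]

/-- `P₁(m₁)`. [cite: Suzuki2012SelfReciprocal, §2.1 (display of P₁(m₁))] -/
def P1 (m : ℝ) : Matrix (Fin 4) (Fin 4) ℝ :=
  !![1, 0, 0, 0;
     0, 1, 0, 0;
     0, 0, 1, 0;
     0, 1, 0, -m]

/-- `Q₁`. [cite: Suzuki2012SelfReciprocal, §2.1 (display of Q₁)] -/
def Q1 : Matrix (Fin 4) (Fin 6) ℝ :=
  !![1, 0, 1, 0, 0, 0;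
     0, 1, 0, 0, 0, 0;
     0, 0, 0, 1, 0, -1;
     0, 0, 0, 0, 0, 0]

/-- `P₂(m₂) = [[V₂⁺, 0], [0, V₂⁻], [0I₂, −m₂·0I₂]]` with `V₂⁺ = [[1,0,0],[0,1,1]]`, `V₂⁻ = [[1,0,0],[0,1,−1]]`
(the `k = 2` instance of the blockwise definition). [cite: Suzuki2012SelfReciprocal, §2.1 (P_k for k ≥ 2), k = 2] -/
def P2 (m : ℝ) : Matrix (Fin 6) (Fin 6) ℝ :=
  !![1, 0, 0, 0, 0, 0;
     0, 1, 1, 0, 0, 0;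
     0, 0, 0, 1, 0, 0;
     0, 0, 0, 0, 1, -1;
     0, 1, 0, 0, -m, 0;
     0, 0, 1, 0, 0, -m]

/-- `Q₂ = [[W₂⁺, 0], [0, W₂⁻], [0, 0]]` with `W₂⁺ = [[1,0,0,1],[0,1,1,0]]`, `W₂⁻ = [[1,0,0,−1],[0,1,−1,0]]`.
[cite: Suzuki2012SelfReciprocal, §2.1 (Q_k for k ≥ 2), k = 2] -/
def Q2 : Matrix (Fin 6) (Fin 8) ℝ :=
  !![1, 0, 0, 1, 0, 0, 0, 0;
     0, 1, 1, 0, 0, 0, 0, 0;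
     0, 0, 0, 0, 1, 0, 0, -1;
     0, 0, 0, 0, 0, 1, -1, 0;
     0, 0, 0, 0, 0, 0, 0, 0;
     0, 0, 0, 0, 0, 0, 0, 0]

/-- `P₃(m₃) = [[V₃⁺, 0], [0, V₃⁻], [0I₃, −m₃·0I₃]]` with `V₃⁺ = [[1,0,0,0],[0,1,0,1],[0,0,1,0]]`,
`V₃⁻ = [[1,0,0,0],[0,1,0,−1]]` (the `k = 3` instance). [cite: Suzuki2012SelfReciprocal, §2.1 (P_k for k ≥ 2), k = 3] -/
def P3 (m : ℝ) : Matrix (Fin 8) (Fin 8) ℝ :=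
  !![1, 0, 0, 0, 0, 0, 0, 0;
     0, 1, 0, 1, 0, 0, 0, 0;
     0, 0, 1, 0, 0, 0, 0, 0;
     0, 0, 0, 0, 1, 0, 0, 0;
     0, 0, 0, 0, 0, 1, 0, -1;
     0, 1, 0, 0, 0, -m, 0, 0;
     0, 0, 1, 0, 0, 0, -m, 0;
     0, 0, 0, 1, 0, 0, 0, -m]

/-- `Q₃ = [[W₃⁺, 0], [0, W₃⁻], [0, 0]]` with `W₃⁺ = [[1,0,0,0,1],[0,1,0,1,0],[0,0,1,0,0]]`,
`W₃⁻ = [[1,0,0,0,−1],[0,1,0,−1,0]]`. [cite: Suzuki2012SelfReciprocal, §2.1 (Q_k for k ≥ 2), k = 3] -/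
def Q3 : Matrix (Fin 8) (Fin 10) ℝ :=
  !![1, 0, 0, 0, 1, 0, 0, 0, 0, 0;
     0, 1, 0, 1, 0, 0, 0, 0, 0, 0;
     0, 0, 1, 0, 0, 0, 0, 0, 0, 0;
     0, 0, 0, 0, 0, 1, 0, 0, 0, -1;
     0, 0, 0, 0, 0, 0, 1, 0, -1, 0;
     0, 0, 0, 0, 0, 0, 0, 0, 0, 0;
     0, 0, 0, 0, 0, 0, 0, 0, 0, 0;
     0, 0, 0, 0, 0, 0, 0, 0, 0, 0]

/-- Lemma 2.1, `k = 1` (`j = 0`): `det P₁(m₁) = −m₁`. [cite: Suzuki2012SelfReciprocal, Lemma 2.1, k = 1] -/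
theorem det_P1 (m : ℝ) : (P1 m).det = -m := by
  simp [P1, Matrix.det_succ_row_zero, Fin.sum_univ_succ, Fin.succAbove]

/-- Lemma 2.1, `k = 2` (`j = 1`): `det P₂(m₂) = 2m₂`. [cite: Suzuki2012SelfReciprocal, Lemma 2.1, k = 2] -/
theorem det_P2 (m : ℝ) : (P2 m).det = 2 * m := by
  simp [P2, Matrix.det_succ_row_zero, Fin.sum_univ_succ, Fin.succAbove]
  ring

/-- The inverse of `P₁(m)` (`m ≠ 0`), written out. [folklore] -/
def P1inv (m : ℝ) : Matrix (Fin 4) (Fin 4) ℝ :=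
  !![1, 0, 0, 0;
     0, 1, 0, 0;
     0, 0, 1, 0;
     0, 1 / m, 0, -1 / m]

/-- The inverse of `P₂(m)` (`m ≠ 0`), written out. [folklore] -/
def P2inv (m : ℝ) : Matrix (Fin 6) (Fin 6) ℝ :=
  !![1, 0, 0, 0, 0, 0;
     0, 1 / 2, 0, m / 2, 1 / 2, -1 / 2;
     0, 1 / 2, 0, -m / 2, -1 / 2, 1 / 2;
     0, 0, 1, 0, 0, 0;
     0, 1 / (2 * m), 0, 1 / 2, -1 / (2 * m), -1 / (2 * m);
     0, 1 / (2 * m), 0, -1 / 2, -1 / (2 * m), -1 / (2 * m)]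

/-- The inverse of `P₃(m)` (`m ≠ 0`), written out. [folklore] -/
def P3inv (m : ℝ) : Matrix (Fin 8) (Fin 8) ℝ :=
  !![1, 0, 0, 0, 0, 0, 0, 0;
     0, 1 / 2, 0, 0, m / 2, 1 / 2, 0, -1 / 2;
     0, 0, 1, 0, 0, 0, 0, 0;
     0, 1 / 2, 0, 0, -m / 2, -1 / 2, 0, 1 / 2;
     0, 0, 0, 1, 0, 0, 0, 0;
     0, 1 / (2 * m), 0, 0, 1 / 2, -1 / (2 * m), 0, -1 / (2 * m);
     0, 0, 1 / m, 0, 0, 0, -1 / m, 0;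
     0, 1 / (2 * m), 0, 0, -1 / 2, -1 / (2 * m), 0, -1 / (2 * m)]

/-- `P₁(m) · P1inv m = 1` for `m ≠ 0` (Lemma 2.2: `P₁(m₁) ∈ GL₄` when `m₁ ≠ 0`, made explicit).
[cite: Suzuki2012SelfReciprocal, Lemma 2.1/2.2 (invertibility of P_k(m_k)), k = 1, explicit inverse] -/
theorem P1_mul_P1inv {m : ℝ} (hm : m ≠ 0) : P1 m * P1inv m = 1 := by
  ext i j
  fin_cases i <;> fin_cases j <;> simp [P1, P1inv, Matrix.mul_apply, Fin.sum_univ_succ] <;>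
    field_simp
  norm_num

/-- `P₂(m) · P2inv m = 1` for `m ≠ 0` (Lemma 2.2: `P₂(m₂) ∈ GL₆` when `m₂ ≠ 0`, made explicit).
[cite: Suzuki2012SelfReciprocal, Lemma 2.1/2.2 (invertibility of P_k(m_k)), k = 2, explicit inverse] -/
theorem P2_mul_P2inv {m : ℝ} (hm : m ≠ 0) : P2 m * P2inv m = 1 := by
  ext i j
  fin_cases i <;> fin_cases j <;> simp [P2, P2inv, Matrix.mul_apply, Fin.sum_univ_succ] <;>
    field_simp <;> ring

/-- `P₃(m) · P3inv m = 1` for `m ≠ 0` (Lemma 2.2: `P₃(m₃) ∈ GL₈` when `m₃ ≠ 0`, made explicit).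
[cite: Suzuki2012SelfReciprocal, Lemma 2.1/2.2 (invertibility of P_k(m_k)), k = 3, explicit inverse] -/
theorem P3_mul_P3inv {m : ℝ} (hm : m ≠ 0) : P3 m * P3inv m = 1 := by
  ext i j
  fin_cases i <;> fin_cases j <;> simp [P3, P3inv, Matrix.mul_apply, Fin.sum_univ_succ] <;>
    field_simp <;> ring

/-- `P₁(m)⁻¹ = P1inv m` (`m ≠ 0`). [cite: Suzuki2012SelfReciprocal, Lemma 2.2 (P_k(m_k) ∈ GL_{2k+2}(K)), k = 1] -/
theorem inv_P1 {m : ℝ} (hm : m ≠ 0) : (P1 m)⁻¹ = P1inv m := Matrix.inv_eq_right_inv (P1_mul_P1inv hm)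

/-- `P₂(m)⁻¹ = P2inv m` (`m ≠ 0`). [cite: Suzuki2012SelfReciprocal, Lemma 2.2 (P_k(m_k) ∈ GL_{2k+2}(K)), k = 2] -/
theorem inv_P2 {m : ℝ} (hm : m ≠ 0) : (P2 m)⁻¹ = P2inv m := Matrix.inv_eq_right_inv (P2_mul_P2inv hm)

/-- `P₃(m)⁻¹ = P3inv m` (`m ≠ 0`). [cite: Suzuki2012SelfReciprocal, Lemma 2.2 (P_k(m_k) ∈ GL_{2k+2}(K)), k = 3] -/
theorem inv_P3 {m : ℝ} (hm : m ≠ 0) : (P3 m)⁻¹ = P3inv m := Matrix.inv_eq_right_inv (P3_mul_P3inv hm)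

/-! ## (def_m1), (def_v1): the quotient and the step, for `k = 3, 2, 1, 0` -/

/-- (def_m1) at `k = 2g − n = 3` (vectors of length `2k + 4 = 10`):
`m₃ = (v[1] + v[5]) / (v[6] − v[10])` (1-based as printed; 0-based here). [cite: Suzuki2012SelfReciprocal, §2.1 (def_m1), k = 3] -/
def mq3 (v : Fin 10 → ℝ) : ℝ := (v 0 + v 4) / (v 5 - v 9)

/-- (def_m1) at `k = 2`: `m₂ = (v[1] + v[4]) / (v[5] − v[8])`. [cite: Suzuki2012SelfReciprocal, §2.1 (def_m1), k = 2] -/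
def mq2 (v : Fin 8 → ℝ) : ℝ := (v 0 + v 3) / (v 4 - v 7)

/-- (def_m1) at `k = 1`: `m₁ = (v[1] + v[3]) / (v[4] − v[6])`. [cite: Suzuki2012SelfReciprocal, §2.1 (def_m1), k = 1] -/
def mq1 (v : Fin 6 → ℝ) : ℝ := (v 0 + v 2) / (v 3 - v 5)

/-- (def_m1) at `k = 0`: `m₀ = (v[1] + v[2]) / (v[3] − v[4])`. [cite: Suzuki2012SelfReciprocal, §2.1 (def_m1), k = 0] -/
def mq0 (v : Fin 4 → ℝ) : ℝ := (v 0 + v 1) / (v 2 - v 3)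

/-- (def_v1) at `k = 3`: `v ↦ P₃(m₃(v))⁻¹ Q₃ v`. [cite: Suzuki2012SelfReciprocal, §2.1 (def_v1), k = 3] -/
def step3 (v : Fin 10 → ℝ) : Fin 8 → ℝ := (P3 (mq3 v))⁻¹ *ᵥ (Q3 *ᵥ v)

/-- (def_v1) at `k = 2`: `v ↦ P₂(m₂(v))⁻¹ Q₂ v`. [cite: Suzuki2012SelfReciprocal, §2.1 (def_v1), k = 2] -/
def step2 (v : Fin 8 → ℝ) : Fin 6 → ℝ := (P2 (mq2 v))⁻¹ *ᵥ (Q2 *ᵥ v)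

/-- (def_v1) at `k = 1`: `v ↦ P₁(m₁(v))⁻¹ Q₁ v`. [cite: Suzuki2012SelfReciprocal, §2.1 (def_v1), k = 1] -/
def step1 (v : Fin 6 → ℝ) : Fin 4 → ℝ := (P1 (mq1 v))⁻¹ *ᵥ (Q1 *ᵥ v)

/-- (def_v1) at `k = 0`: `v ↦ P₀⁻¹ Q₀ v` (`P₀(m₀) := P₀`). [cite: Suzuki2012SelfReciprocal, §2.1 (def_v1), k = 0] -/
def step0 (v : Fin 4 → ℝ) : Fin 2 → ℝ := P0⁻¹ *ᵥ (Q0 *ᵥ v)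

/-- `P₀⁻¹ = 1` (`P₀(m₀) := P₀ = I₂`). [cite: Suzuki2012SelfReciprocal, §2.1 (def_v1) («where P₀(m₀) := P₀»)] -/
theorem inv_P0 : P0⁻¹ = 1 := by
  have : P0 = 1 := by
    ext i j; fin_cases i <;> fin_cases j <;> simp [P0]
  rw [this, inv_one]

/-! ## Genus one: the chain `v₁(0) → v₁(1) → v₁(2)` -/

namespace GenusOne

/-- (def_v0) for `g = 1`: `v₁(0) = ᵗ(c₀, c₁, c₀; c₀ log q, 0, −c₀ log q)`, `L = log q`.
[cite: Suzuki2012SelfReciprocal, §2.2 (def_v0), g = 1] -/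
def v0Rec (c₀ c₁ L : ℝ) : Fin 6 → ℝ := ![c₀, c₁, c₀, c₀ * L, 0, -(c₀ * L)]

/-- `v₁(1) = P₁(m₁)⁻¹Q₁v₁(0)`. [cite: Suzuki2012SelfReciprocal, §2.1–2.2 (def_v1), g = 1, n = 1] -/
def v1Rec (c₀ c₁ L : ℝ) : Fin 4 → ℝ := step1 (v0Rec c₀ c₁ L)

/-- `v₁(2) = P₀⁻¹Q₀v₁(1)`. [cite: Suzuki2012SelfReciprocal, §2.1–2.2 (def_v1), g = 1, n = 2] -/
def v2Rec (c₀ c₁ L : ℝ) : Fin 2 → ℝ := step0 (v1Rec c₀ c₁ L)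

/-- The recursion's `m₁(c; log q)` (`n = 1`). [cite: Suzuki2012SelfReciprocal, §2.2 (def_m2), g = 1, n = 1] -/
def mRec₁ (c₀ c₁ L : ℝ) : ℝ := mq1 (v0Rec c₀ c₁ L)

/-- The recursion's `m₀(c; log q)` (`n = 2`). [cite: Suzuki2012SelfReciprocal, §2.2 (def_m2), g = 1, n = 2] -/
def mRec₀ (c₀ c₁ L : ℝ) : ℝ := mq0 (v1Rec c₀ c₁ L)

/-- (def_mg) for `g = 1`: `m₂ := 1/(g log q) = 1/L`. [cite: Suzuki2012SelfReciprocal, §2.2 (def_mg), g = 1] -/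
def mRec₂ (L : ℝ) : ℝ := 1 / L

/-- (def_R), `g = 1`: `R₁ = m₁/m₂`. [cite: Suzuki2012SelfReciprocal, §2.2 (def_R), g = 1, n = 1] -/
def RRec₁ (c₀ c₁ L : ℝ) : ℝ := mRec₁ c₀ c₁ L / mRec₂ L

/-- (def_R), `g = 1`: `R₂ = m₀/m₁`. [cite: Suzuki2012SelfReciprocal, §2.2 (def_R), g = 1, n = 2] -/
def RRec₂ (c₀ c₁ L : ℝ) : ℝ := mRec₀ c₀ c₁ L / mRec₁ c₀ c₁ L

/-- `m₁ = 1/L` (for `c₀, L ≠ 0`). [cite: Suzuki2012SelfReciprocal, §2.2, g = 1 (recursion evaluated)] -/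
theorem mRec₁_eq {c₀ L : ℝ} (c₁ : ℝ) (h₀ : c₀ ≠ 0) (hL : L ≠ 0) : mRec₁ c₀ c₁ L = 1 / L := by
  simp [mRec₁, mq1, v0Rec]
  field_simp

/-- `v₁(1) = ᵗ(2c₀, c₁, 2c₀L, c₁L)`. [cite: Suzuki2012SelfReciprocal, §2.2, g = 1 (recursion evaluated)] -/
theorem v1Rec_eq {c₀ L : ℝ} (c₁ : ℝ) (h₀ : c₀ ≠ 0) (hL : L ≠ 0) :
    v1Rec c₀ c₁ L = ![2 * c₀, c₁, 2 * c₀ * L, c₁ * L] := by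
  have hm : mq1 (v0Rec c₀ c₁ L) ≠ 0 := by
    have := mRec₁_eq c₁ h₀ hL; rw [mRec₁] at this; rw [this]; exact one_div_ne_zero hL
  unfold v1Rec step1
  rw [inv_P1 hm]
  have e : mq1 (v0Rec c₀ c₁ L) = 1 / L := by have := mRec₁_eq c₁ h₀ hL; rwa [mRec₁] at this
  rw [e]
  ext i
  fin_cases i <;> simp [P1inv, Q1, v0Rec, Matrix.mulVec, dotProduct, Fin.sum_univ_succ] <;> ring

/-- `m₀ = (2c₀ + c₁)/(L(2c₀ − c₁))`. [cite: Suzuki2012SelfReciprocal, §2.2, g = 1 (recursion evaluated)] -/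
theorem mRec₀_eq {c₀ L : ℝ} (c₁ : ℝ) (h₀ : c₀ ≠ 0) (hL : L ≠ 0) :
    mRec₀ c₀ c₁ L = (2 * c₀ + c₁) / (L * (2 * c₀ - c₁)) := by
  rw [mRec₀, v1Rec_eq c₁ h₀ hL, mq0]
  simp
  rw [show 2 * c₀ * L - c₁ * L = L * (2 * c₀ - c₁) by ring]

/-- `v₁(2) = ᵗ(2c₀ + c₁, L(2c₀ − c₁))`. [cite: Suzuki2012SelfReciprocal, §2.2, g = 1 (recursion evaluated)] -/
theorem v2Rec_eq {c₀ L : ℝ} (c₁ : ℝ) (h₀ : c₀ ≠ 0) (hL : L ≠ 0) :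
    v2Rec c₀ c₁ L = ![2 * c₀ + c₁, L * (2 * c₀ - c₁)] := by
  unfold v2Rec step0
  rw [inv_P0, v1Rec_eq c₁ h₀ hL, Matrix.one_mulVec]
  ext i
  fin_cases i <;> simp [Q0, Matrix.mulVec, dotProduct, Fin.sum_univ_succ]
  ring

/-- **The table for `g = 1` from the recursion**: `R₁ = 1` and `R₂ = (2c₀ + c₁)/(2c₀ − c₁)` (the
companion file's `GenusOne.R₂`), for `c₀, L ≠ 0` and off `2c₀ = c₁`.
[cite: Suzuki2012SelfReciprocal, §2.2 (small table, g = 1, «calculated by hand according to the definition»)] -/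
theorem RRec_eq_table {c₀ L : ℝ} (c₁ : ℝ) (h₀ : c₀ ≠ 0) (hL : L ≠ 0) (h₁ : 2 * c₀ - c₁ ≠ 0) :
    RRec₁ c₀ c₁ L = 1 ∧ RRec₂ c₀ c₁ L = R₂ c₀ c₁ := by
  refine ⟨?_, ?_⟩
  · rw [RRec₁, mRec₁_eq c₁ h₀ hL, mRec₂]; exact div_self (one_div_ne_zero hL)
  · rw [RRec₂, mRec₀_eq c₁ h₀ hL, mRec₁_eq c₁ h₀ hL, R₂]
    field_simp

end GenusOne

/-! ## Genus two: the chain `v₂(0) → v₂(1) → v₂(2) → v₂(3) → v₂(4)` -/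

namespace GenusTwo

/-- (def_v0) for `g = 2`: `v₂(0) = ᵗ(c₀, c₁, c₂, c₁, c₀; c₀ log q², c₁ log q, 0, −c₁ log q, −c₀ log q²)`,
`L = log q`. [cite: Suzuki2012SelfReciprocal, §2.2 (def_v0), g = 2] -/
def v0Rec (c₀ c₁ c₂ L : ℝ) : Fin 10 → ℝ :=
  ![c₀, c₁, c₂, c₁, c₀, c₀ * (2 * L), c₁ * L, 0, -(c₁ * L), -(c₀ * (2 * L))]

/-- `v₂(1) = P₃(m₃)⁻¹Q₃v₂(0)`. [cite: Suzuki2012SelfReciprocal, §2.1–2.2 (def_v1), g = 2, n = 1] -/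
def v1Rec (c₀ c₁ c₂ L : ℝ) : Fin 8 → ℝ := step3 (v0Rec c₀ c₁ c₂ L)

/-- `v₂(2) = P₂(m₂)⁻¹Q₂v₂(1)`. [cite: Suzuki2012SelfReciprocal, §2.1–2.2 (def_v1), g = 2, n = 2] -/
def v2Rec (c₀ c₁ c₂ L : ℝ) : Fin 6 → ℝ := step2 (v1Rec c₀ c₁ c₂ L)

/-- `v₂(3) = P₁(m₁)⁻¹Q₁v₂(2)`. [cite: Suzuki2012SelfReciprocal, §2.1–2.2 (def_v1), g = 2, n = 3] -/
def v3Rec (c₀ c₁ c₂ L : ℝ) : Fin 4 → ℝ := step1 (v2Rec c₀ c₁ c₂ L)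

/-- `v₂(4) = P₀⁻¹Q₀v₂(3)`. [cite: Suzuki2012SelfReciprocal, §2.1–2.2 (def_v1), g = 2, n = 4] -/
def v4Rec (c₀ c₁ c₂ L : ℝ) : Fin 2 → ℝ := step0 (v3Rec c₀ c₁ c₂ L)

/-- The recursion's `m₃(c; log q)` (`n = 1`). [cite: Suzuki2012SelfReciprocal, §2.2 (def_m2), g = 2, n = 1] -/
def mRec₃ (c₀ c₁ c₂ L : ℝ) : ℝ := mq3 (v0Rec c₀ c₁ c₂ L)

/-- The recursion's `m₂(c; log q)` (`n = 2`). [cite: Suzuki2012SelfReciprocal, §2.2 (def_m2), g = 2, n = 2] -/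
def mRec₂ (c₀ c₁ c₂ L : ℝ) : ℝ := mq2 (v1Rec c₀ c₁ c₂ L)

/-- The recursion's `m₁(c; log q)` (`n = 3`). [cite: Suzuki2012SelfReciprocal, §2.2 (def_m2), g = 2, n = 3] -/
def mRec₁ (c₀ c₁ c₂ L : ℝ) : ℝ := mq1 (v2Rec c₀ c₁ c₂ L)

/-- The recursion's `m₀(c; log q)` (`n = 4`). [cite: Suzuki2012SelfReciprocal, §2.2 (def_m2), g = 2, n = 4] -/
def mRec₀ (c₀ c₁ c₂ L : ℝ) : ℝ := mq0 (v3Rec c₀ c₁ c₂ L)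

/-- (def_mg) for `g = 2`: `m₄ := 1/(g log q) = 1/(2L)`. [cite: Suzuki2012SelfReciprocal, §2.2 (def_mg), g = 2] -/
def mRec₄ (L : ℝ) : ℝ := 1 / (2 * L)

/-- (def_R), `g = 2`, `n = 1` (`J = 0`): `R₁ = m₃/m₄`. [cite: Suzuki2012SelfReciprocal, §2.2 (def_R), g = 2, n = 1] -/
def RRec₁ (c₀ c₁ c₂ L : ℝ) : ℝ := mRec₃ c₀ c₁ c₂ L / mRec₄ L

/-- (def_R), `g = 2`, `n = 2` (`J = 0`): `R₂ = m₂/m₃`. [cite: Suzuki2012SelfReciprocal, §2.2 (def_R), g = 2, n = 2] -/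
def RRec₂ (c₀ c₁ c₂ L : ℝ) : ℝ := mRec₂ c₀ c₁ c₂ L / mRec₃ c₀ c₁ c₂ L

/-- (def_R), `g = 2`, `n = 3` (`J = 1`): `R₃ = (m₃/m₄)(m₁/m₂)`. [cite: Suzuki2012SelfReciprocal, §2.2 (def_R), g = 2, n = 3] -/
def RRec₃ (c₀ c₁ c₂ L : ℝ) : ℝ :=
  mRec₃ c₀ c₁ c₂ L / mRec₄ L * (mRec₁ c₀ c₁ c₂ L / mRec₂ c₀ c₁ c₂ L)

/-- (def_R), `g = 2`, `n = 4` (`J = 1`): `R₄ = (m₂/m₃)(m₀/m₁)`. [cite: Suzuki2012SelfReciprocal, §2.2 (def_R), g = 2, n = 4] -/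
def RRec₄ (c₀ c₁ c₂ L : ℝ) : ℝ :=
  mRec₂ c₀ c₁ c₂ L / mRec₃ c₀ c₁ c₂ L * (mRec₀ c₀ c₁ c₂ L / mRec₁ c₀ c₁ c₂ L)

section Chain

variable {c₀ c₁ c₂ L : ℝ}

/-- `m₃ = 1/(2L)` (for `c₀, L ≠ 0`). [cite: Suzuki2012SelfReciprocal, §2.2, g = 2 (recursion evaluated)] -/
theorem mRec₃_eq (h₀ : c₀ ≠ 0) (hL : L ≠ 0) : mRec₃ c₀ c₁ c₂ L = 1 / (2 * L) := by
  simp [mRec₃, mq3, v0Rec]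
  field_simp

/-- `v₂(1) = ᵗ(2c₀, 3c₁/2, c₂, c₁/2, 4c₀L, 3c₁L, 2c₂L, c₁L)`.
[cite: Suzuki2012SelfReciprocal, §2.2, g = 2 (recursion evaluated)] -/
theorem v1Rec_eq (h₀ : c₀ ≠ 0) (hL : L ≠ 0) :
    v1Rec c₀ c₁ c₂ L =
      ![2 * c₀, 3 * c₁ / 2, c₂, c₁ / 2, 4 * c₀ * L, 3 * c₁ * L, 2 * c₂ * L, c₁ * L] := by
  have e : mq3 (v0Rec c₀ c₁ c₂ L) = 1 / (2 * L) := by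
    have := mRec₃_eq (c₁ := c₁) (c₂ := c₂) h₀ hL; rwa [mRec₃] at this
  have hm : mq3 (v0Rec c₀ c₁ c₂ L) ≠ 0 := by
    rw [e]; exact one_div_ne_zero (mul_ne_zero two_ne_zero hL)
  unfold v1Rec step3
  rw [inv_P3 hm, e]
  ext i
  fin_cases i <;> simp [P3inv, Q3, v0Rec, Matrix.mulVec, dotProduct, Fin.sum_univ_succ]
  · ring
  · field_simp
    ring
  · field_simp
    ring
  · ring
  · ring
  · ring
  · ring

/-- `m₂ = (4c₀ + c₁)/(2L(4c₀ − c₁))` (for `c₀, L ≠ 0`).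
[cite: Suzuki2012SelfReciprocal, §2.2, g = 2 (recursion evaluated)] -/
theorem mRec₂_eq (h₀ : c₀ ≠ 0) (hL : L ≠ 0) (h₁ : 4 * c₀ - c₁ ≠ 0) :
    mRec₂ c₀ c₁ c₂ L = (4 * c₀ + c₁) / (2 * L * (4 * c₀ - c₁)) := by
  rw [mRec₂, v1Rec_eq h₀ hL, mq2]
  simp only [Matrix.cons_val_zero, Matrix.cons_val]
  have hd : 4 * c₀ * L - c₁ * L ≠ 0 := by
    rw [show 4 * c₀ * L - c₁ * L = L * (4 * c₀ - c₁) by ring]; exact mul_ne_zero hL h₁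
  rw [div_eq_div_iff hd (mul_ne_zero (mul_ne_zero two_ne_zero hL) h₁)]
  ring

/-- `v₂(2) = ᵗ((4c₀+c₁)/2, c₁(6c₀−c₂)/(4c₀−c₁), (8c₀c₂−3c₁²)/(2(4c₀−c₁)); L(4c₀−c₁), 2Lc₁(6c₀−c₂)/(4c₀+c₁),
L(8c₀c₂−3c₁²)/(4c₀+c₁))` (generic `c`: `c₀, L, 4c₀ ∓ c₁ ≠ 0`).
[cite: Suzuki2012SelfReciprocal, §2.2, g = 2 (recursion evaluated)] -/
theorem v2Rec_eq (h₀ : c₀ ≠ 0) (hL : L ≠ 0) (h₁ : 4 * c₀ - c₁ ≠ 0) (h₂ : 4 * c₀ + c₁ ≠ 0) :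
    v2Rec c₀ c₁ c₂ L =
      ![(4 * c₀ + c₁) / 2, c₁ * (6 * c₀ - c₂) / (4 * c₀ - c₁),
        (8 * c₀ * c₂ - 3 * c₁ ^ 2) / (2 * (4 * c₀ - c₁)), L * (4 * c₀ - c₁),
        2 * L * c₁ * (6 * c₀ - c₂) / (4 * c₀ + c₁), L * (8 * c₀ * c₂ - 3 * c₁ ^ 2) / (4 * c₀ + c₁)] := by
  have e : mq2 (v1Rec c₀ c₁ c₂ L) = (4 * c₀ + c₁) / (2 * L * (4 * c₀ - c₁)) := by
    have := mRec₂_eq (c₂ := c₂) h₀ hL h₁; rwa [mRec₂] at this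
  have hm : mq2 (v1Rec c₀ c₁ c₂ L) ≠ 0 := by
    rw [e]; exact div_ne_zero h₂ (mul_ne_zero (mul_ne_zero two_ne_zero hL) h₁)
  unfold v2Rec step2
  rw [inv_P2 hm, e, v1Rec_eq h₀ hL]
  ext i
  fin_cases i <;> simp [P2inv, Q2, Matrix.mulVec, dotProduct, Fin.sum_univ_succ]
  all_goals first | ring1 | (field_simp; done) | (field_simp; ring1)

/-- `m₁ = (4c₀+c₁)(4c₀²+2c₀c₂−c₁²) / (L(4c₀−c₁)(8c₀²−4c₀c₂+c₁²))` (generic `c`).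
[cite: Suzuki2012SelfReciprocal, §2.2, g = 2 (recursion evaluated)] -/
theorem mRec₁_eq (h₀ : c₀ ≠ 0) (hL : L ≠ 0) (h₁ : 4 * c₀ - c₁ ≠ 0) (h₂ : 4 * c₀ + c₁ ≠ 0) :
    mRec₁ c₀ c₁ c₂ L = (4 * c₀ + c₁) * (4 * c₀ ^ 2 + 2 * c₀ * c₂ - c₁ ^ 2) /
      (L * (4 * c₀ - c₁) * (8 * c₀ ^ 2 - 4 * c₀ * c₂ + c₁ ^ 2)) := by
  rw [mRec₁, v2Rec_eq h₀ hL h₁ h₂, mq1]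
  simp only [Matrix.cons_val_zero, Matrix.cons_val]
  have hn : (4 * c₀ + c₁) / 2 + (8 * c₀ * c₂ - 3 * c₁ ^ 2) / (2 * (4 * c₀ - c₁)) =
      2 * (4 * c₀ ^ 2 + 2 * c₀ * c₂ - c₁ ^ 2) / (4 * c₀ - c₁) := by
    field_simp
    ring
  have hd : L * (4 * c₀ - c₁) - L * (8 * c₀ * c₂ - 3 * c₁ ^ 2) / (4 * c₀ + c₁) =
      2 * L * (8 * c₀ ^ 2 - 4 * c₀ * c₂ + c₁ ^ 2) / (4 * c₀ + c₁) := by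
    field_simp
    ring
  rw [hn, hd]
  field_simp

/-- `v₂(3) = ᵗ(2(4c₀²+2c₀c₂−c₁²)/(4c₀−c₁), c₁(6c₀−c₂)/(4c₀−c₁); 2L(8c₀²−4c₀c₂+c₁²)/(4c₀+c₁),
Lc₁(6c₀−c₂)(8c₀²−4c₀c₂+c₁²)/((4c₀+c₁)(4c₀²+2c₀c₂−c₁²)))` (generic `c`).
[cite: Suzuki2012SelfReciprocal, §2.2, g = 2 (recursion evaluated)] -/
theorem v3Rec_eq (h₀ : c₀ ≠ 0) (hL : L ≠ 0) (h₁ : 4 * c₀ - c₁ ≠ 0) (h₂ : 4 * c₀ + c₁ ≠ 0)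
    (h₃ : 8 * c₀ ^ 2 - 4 * c₀ * c₂ + c₁ ^ 2 ≠ 0) (h₄ : 4 * c₀ ^ 2 + 2 * c₀ * c₂ - c₁ ^ 2 ≠ 0) :
    v3Rec c₀ c₁ c₂ L =
      ![2 * (4 * c₀ ^ 2 + 2 * c₀ * c₂ - c₁ ^ 2) / (4 * c₀ - c₁), c₁ * (6 * c₀ - c₂) / (4 * c₀ - c₁),
        2 * L * (8 * c₀ ^ 2 - 4 * c₀ * c₂ + c₁ ^ 2) / (4 * c₀ + c₁),
        L * c₁ * (6 * c₀ - c₂) * (8 * c₀ ^ 2 - 4 * c₀ * c₂ + c₁ ^ 2) /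
          ((4 * c₀ + c₁) * (4 * c₀ ^ 2 + 2 * c₀ * c₂ - c₁ ^ 2))] := by
  have e : mq1 (v2Rec c₀ c₁ c₂ L) = (4 * c₀ + c₁) * (4 * c₀ ^ 2 + 2 * c₀ * c₂ - c₁ ^ 2) /
      (L * (4 * c₀ - c₁) * (8 * c₀ ^ 2 - 4 * c₀ * c₂ + c₁ ^ 2)) := by
    have := mRec₁_eq (c₂ := c₂) h₀ hL h₁ h₂; rwa [mRec₁] at this
  have hm : mq1 (v2Rec c₀ c₁ c₂ L) ≠ 0 := by
    rw [e]; exact div_ne_zero (mul_ne_zero h₂ h₄) (mul_ne_zero (mul_ne_zero hL h₁) h₃)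
  unfold v3Rec step1
  rw [inv_P1 hm, e, v2Rec_eq h₀ hL h₁ h₂]
  ext i
  fin_cases i <;> simp [P1inv, Q1, Matrix.mulVec, dotProduct, Fin.sum_univ_succ]
  all_goals first | ring1 | (field_simp; done) | (field_simp; ring1)

/-- The two combinations of `v₂(3)` entering the last step: `v₂(3)[1] + v₂(3)[2] = 2c₀ + 2c₁ + c₂`
(`= P₂(1)`). [folklore] -/
private theorem v3_sum (h₁ : 4 * c₀ - c₁ ≠ 0) :
    2 * (4 * c₀ ^ 2 + 2 * c₀ * c₂ - c₁ ^ 2) / (4 * c₀ - c₁) + c₁ * (6 * c₀ - c₂) / (4 * c₀ - c₁) =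
      2 * c₀ + 2 * c₁ + c₂ := by
  rw [← add_div, div_eq_iff h₁]
  ring

/-- … and `v₂(3)[3] − v₂(3)[4] = L(8c₀²−4c₀c₂+c₁²)(2c₀−2c₁+c₂)/(4c₀²+2c₀c₂−c₁²)`. [folklore] -/
private theorem v3_diff (h₂ : 4 * c₀ + c₁ ≠ 0) (h₄ : 4 * c₀ ^ 2 + 2 * c₀ * c₂ - c₁ ^ 2 ≠ 0) :
    2 * L * (8 * c₀ ^ 2 - 4 * c₀ * c₂ + c₁ ^ 2) / (4 * c₀ + c₁) -
        L * c₁ * (6 * c₀ - c₂) * (8 * c₀ ^ 2 - 4 * c₀ * c₂ + c₁ ^ 2) /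
          ((4 * c₀ + c₁) * (4 * c₀ ^ 2 + 2 * c₀ * c₂ - c₁ ^ 2)) =
      L * (8 * c₀ ^ 2 - 4 * c₀ * c₂ + c₁ ^ 2) * (2 * c₀ - 2 * c₁ + c₂) /
        (4 * c₀ ^ 2 + 2 * c₀ * c₂ - c₁ ^ 2) := by
  rw [div_sub_div _ _ h₂ (mul_ne_zero h₂ h₄),
    div_eq_div_iff (mul_ne_zero h₂ (mul_ne_zero h₂ h₄)) h₄]
  ring

/-- `m₀ = (2c₀+2c₁+c₂)(4c₀²+2c₀c₂−c₁²) / (L(2c₀−2c₁+c₂)(8c₀²−4c₀c₂+c₁²))` (generic `c`).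
[cite: Suzuki2012SelfReciprocal, §2.2, g = 2 (recursion evaluated)] -/
theorem mRec₀_eq (h₀ : c₀ ≠ 0) (hL : L ≠ 0) (h₁ : 4 * c₀ - c₁ ≠ 0) (h₂ : 4 * c₀ + c₁ ≠ 0)
    (h₃ : 8 * c₀ ^ 2 - 4 * c₀ * c₂ + c₁ ^ 2 ≠ 0) (h₄ : 4 * c₀ ^ 2 + 2 * c₀ * c₂ - c₁ ^ 2 ≠ 0)
    (h₅ : 2 * c₀ - 2 * c₁ + c₂ ≠ 0) :
    mRec₀ c₀ c₁ c₂ L = (2 * c₀ + 2 * c₁ + c₂) * (4 * c₀ ^ 2 + 2 * c₀ * c₂ - c₁ ^ 2) /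
      (L * (2 * c₀ - 2 * c₁ + c₂) * (8 * c₀ ^ 2 - 4 * c₀ * c₂ + c₁ ^ 2)) := by
  rw [mRec₀, v3Rec_eq h₀ hL h₁ h₂ h₃ h₄, mq0]
  simp only [Matrix.cons_val_zero, Matrix.cons_val_one, Matrix.cons_val]
  rw [v3_sum h₁, v3_diff h₂ h₄,
    div_eq_div_iff (div_ne_zero (mul_ne_zero (mul_ne_zero hL h₃) h₅) h₄)
      (mul_ne_zero (mul_ne_zero hL h₅) h₃), ← mul_div_assoc, eq_div_iff h₄]
  ring

/-- `Q₀ v = ᵗ(v[1] + v[2], v[3] − v[4])`. [folklore] -/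
private theorem Q0_mulVec (v : Fin 4 → ℝ) : Q0 *ᵥ v = ![v 0 + v 1, v 2 - v 3] := by
  ext i
  fin_cases i <;> simp [Q0, Matrix.mulVec, dotProduct, Fin.sum_univ_succ]
  ring

/-- `v₂(4) = ᵗ(2c₀ + 2c₁ + c₂, L(8c₀²−4c₀c₂+c₁²)(2c₀−2c₁+c₂)/(4c₀²+2c₀c₂−c₁²))` (generic `c`) — note
`v₂(4)[1] = P₂(1)`. [cite: Suzuki2012SelfReciprocal, §2.2, g = 2 (recursion evaluated)] -/
theorem v4Rec_eq (h₀ : c₀ ≠ 0) (hL : L ≠ 0) (h₁ : 4 * c₀ - c₁ ≠ 0) (h₂ : 4 * c₀ + c₁ ≠ 0)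
    (h₃ : 8 * c₀ ^ 2 - 4 * c₀ * c₂ + c₁ ^ 2 ≠ 0) (h₄ : 4 * c₀ ^ 2 + 2 * c₀ * c₂ - c₁ ^ 2 ≠ 0) :
    v4Rec c₀ c₁ c₂ L =
      ![2 * c₀ + 2 * c₁ + c₂,
        L * (8 * c₀ ^ 2 - 4 * c₀ * c₂ + c₁ ^ 2) * (2 * c₀ - 2 * c₁ + c₂) /
          (4 * c₀ ^ 2 + 2 * c₀ * c₂ - c₁ ^ 2)] := by
  unfold v4Rec step0
  rw [inv_P0, v3Rec_eq h₀ hL h₁ h₂ h₃ h₄, Matrix.one_mulVec, Q0_mulVec]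
  simp only [Matrix.cons_val_zero, Matrix.cons_val_one, Matrix.cons_val]
  rw [v3_sum h₁, v3_diff h₂ h₄]

/-- **The printed table for `g = 2` from the recursion.** In generic position (`L = log q ≠ 0`,
`c₀ ≠ 0`, and off the divisors `4c₀ = ±c₁`, `8c₀² − 4c₀c₂ + c₁² = 0`, `4c₀² + 2c₀c₂ − c₁² = 0`,
`2c₀ − 2c₁ + c₂ = 0`, on which some `m_{2g−n}` is `0` or `∞`), the numbers `R₁, …, R₄` produced by
(def_v0)/(def_m1)/(def_v1)/(def_mg)/(def_R) are the printed `R₁ = 1`, `R₂ = (4c₀+c₁)/(4c₀−c₁)`,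
`R₃ = (8c₀²−2c₁²+4c₀c₂)/(8c₀²+c₁²−4c₀c₂)`, `R₄ = (2c₀+2c₁+c₂)/(2c₀−2c₁+c₂)` (the companion file's
`GenusTwo.R₂ R₃ R₄`); in particular they do not depend on `q`.
[cite: Suzuki2012SelfReciprocal, §2.2 (small table, g = 2, «calculated by hand according to the definition»)] -/
theorem RRec_eq_table (h₀ : c₀ ≠ 0) (hL : L ≠ 0) (h₁ : 4 * c₀ - c₁ ≠ 0) (h₂ : 4 * c₀ + c₁ ≠ 0)
    (h₃ : 8 * c₀ ^ 2 - 4 * c₀ * c₂ + c₁ ^ 2 ≠ 0) (h₄ : 4 * c₀ ^ 2 + 2 * c₀ * c₂ - c₁ ^ 2 ≠ 0)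
    (h₅ : 2 * c₀ - 2 * c₁ + c₂ ≠ 0) :
    RRec₁ c₀ c₁ c₂ L = 1 ∧ RRec₂ c₀ c₁ c₂ L = R₂ c₀ c₁ c₂ ∧ RRec₃ c₀ c₁ c₂ L = R₃ c₀ c₁ c₂ ∧
      RRec₄ c₀ c₁ c₂ L = R₄ c₀ c₁ c₂ := by
  have h₃' : 8 * c₀ ^ 2 + c₁ ^ 2 - 4 * c₀ * c₂ ≠ 0 := by
    intro h; apply h₃; linarith
  have h2L : 2 * L ≠ 0 := mul_ne_zero two_ne_zero hL
  have e3 := mRec₃_eq (c₁ := c₁) (c₂ := c₂) h₀ hL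
  have e2 := mRec₂_eq (c₂ := c₂) h₀ hL h₁
  have e1 := mRec₁_eq (c₂ := c₂) h₀ hL h₁ h₂
  have e0 := mRec₀_eq h₀ hL h₁ h₂ h₃ h₄ h₅
  -- the three elementary quotients
  have q34 : mRec₃ c₀ c₁ c₂ L / mRec₄ L = 1 := by
    rw [e3, mRec₄]; exact div_self (one_div_ne_zero h2L)
  have q23 : mRec₂ c₀ c₁ c₂ L / mRec₃ c₀ c₁ c₂ L = (4 * c₀ + c₁) / (4 * c₀ - c₁) := by
    rw [e2, e3, div_div_div_eq, mul_one, div_eq_div_iff (mul_ne_zero h2L h₁) h₁]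
    ring
  have q12 : mRec₁ c₀ c₁ c₂ L / mRec₂ c₀ c₁ c₂ L =
      2 * (4 * c₀ ^ 2 + 2 * c₀ * c₂ - c₁ ^ 2) / (8 * c₀ ^ 2 - 4 * c₀ * c₂ + c₁ ^ 2) := by
    rw [e1, e2, div_div_div_eq,
      div_eq_div_iff (mul_ne_zero (mul_ne_zero (mul_ne_zero hL h₁) h₃) h₂) h₃]
    ring
  have q01 : mRec₀ c₀ c₁ c₂ L / mRec₁ c₀ c₁ c₂ L =
      (2 * c₀ + 2 * c₁ + c₂) * (4 * c₀ - c₁) / ((2 * c₀ - 2 * c₁ + c₂) * (4 * c₀ + c₁)) := by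
    rw [e0, e1, div_div_div_eq,
      div_eq_div_iff (mul_ne_zero (mul_ne_zero (mul_ne_zero hL h₅) h₃) (mul_ne_zero h₂ h₄))
        (mul_ne_zero h₅ h₂)]
    ring
  refine ⟨?_, ?_, ?_, ?_⟩
  · rw [RRec₁, q34]
  · rw [RRec₂, q23, R₂]
  · rw [RRec₃, q34, one_mul, q12, R₃, div_eq_div_iff h₃ h₃']
    ring
  · rw [RRec₄, q23, q01, R₄, div_mul_div_comm,
      div_eq_div_iff (mul_ne_zero h₁ (mul_ne_zero h₅ h₂)) h₅]
    ring

/-- **(rel_mR) for `g = 2` in the kernel**: in generic position the recursion's `m₃, m₂, m₁, m₀` equal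
`R_{n−1}R_n/(2 log q)` with the printed table, i.e. the companion file's `GenusTwo.m₃ m₂ m₁ m₀`
(so its Theorem 2.4 (`g = 2`) `GenusTwo.onCircleSimple_iff_m_pos` is about the source's own `m`'s).
[cite: Suzuki2012SelfReciprocal, §2.2 (rel_mR), g = 2] -/
theorem mRec_eq_m (h₀ : c₀ ≠ 0) (hL : L ≠ 0) (h₁ : 4 * c₀ - c₁ ≠ 0) (h₂ : 4 * c₀ + c₁ ≠ 0)
    (h₃ : 8 * c₀ ^ 2 - 4 * c₀ * c₂ + c₁ ^ 2 ≠ 0) (h₄ : 4 * c₀ ^ 2 + 2 * c₀ * c₂ - c₁ ^ 2 ≠ 0)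
    (h₅ : 2 * c₀ - 2 * c₁ + c₂ ≠ 0) :
    mRec₃ c₀ c₁ c₂ L = m₃ c₀ c₁ c₂ L ∧ mRec₂ c₀ c₁ c₂ L = m₂ c₀ c₁ c₂ L ∧
      mRec₁ c₀ c₁ c₂ L = m₁ c₀ c₁ c₂ L ∧ mRec₀ c₀ c₁ c₂ L = m₀ c₀ c₁ c₂ L := by
  have h₃' : 8 * c₀ ^ 2 + c₁ ^ 2 - 4 * c₀ * c₂ ≠ 0 := by
    intro h; apply h₃; linarith
  have h2L : 2 * L ≠ 0 := mul_ne_zero two_ne_zero hL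
  refine ⟨?_, ?_, ?_, ?_⟩
  · rw [mRec₃_eq (c₁ := c₁) (c₂ := c₂) h₀ hL, m₃]
    ring
  · rw [mRec₂_eq (c₂ := c₂) h₀ hL h₁, m₂, R₂, one_mul, div_div,
      div_eq_div_iff (mul_ne_zero h2L h₁) (mul_ne_zero h₁ h2L)]
    ring
  · rw [mRec₁_eq (c₂ := c₂) h₀ hL h₁ h₂, m₁, R₂, R₃, div_mul_div_comm, div_div,
      div_eq_div_iff (mul_ne_zero (mul_ne_zero hL h₁) h₃) (mul_ne_zero (mul_ne_zero h₁ h₃') h2L)]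
    ring
  · rw [mRec₀_eq h₀ hL h₁ h₂ h₃ h₄ h₅, m₀, R₃, R₄, div_mul_div_comm, div_div,
      div_eq_div_iff (mul_ne_zero (mul_ne_zero hL h₅) h₃) (mul_ne_zero (mul_ne_zero h₃' h₅) h2L)]
    ring

end Chain

end GenusTwo

/-! ## Lemma 2.3: the block formula `P_k(m_k)⁻¹Q_k = [[M_{k,1}, M_{k,2}], [M_{k,3}, M_{k,4}]]` for `k ≤ 3`

(Appended 2026-08-27, cell `rh-dbr` eng-6 g7.) The proof of Lemma 2.3 of the source displays
`P₀⁻¹Q₀`, `P₁(m₁)⁻¹Q₁` explicitly and `P_k(m_k)⁻¹Q_k` for `k ≥ 2` through four `(k+1) × (k+2)`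
blocks `M_{k,1} = ½(e_i + e_{k+2−i})`-type, `M_{k,2} = (m_k/2)(…)`, `M_{k,3} = (1/(2m_k))(…)`,
`M_{k,4} = ½(…)` (separate displays for `k` odd / even). Here: the four block matrices for
`k = 0, 1, 2, 3` as ONE literal `(2k+2) × (2k+4)` matrix each (`PinvQ0 … PinvQ3`; rows `1…k+1` =
`[M_{k,1} M_{k,2}]`, rows `k+2…2k+2` = `[M_{k,3} M_{k,4}]`), the identities `P_k⁻¹Q_k = PinvQk`
(`P1inv_mul_Q1` …; with `inv_P1 …` for the honest inverse), and Lemma 2.3 itself for `k ≤ 3`: the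
first and the `(k+2)`-nd entries of `P_k(m)⁻¹Q_k v` are `v[1] + v[k+2]` and `v[k+3] − v[2k+4]`
WHATEVER `m` is (`PinvQk_mulVec_zero`, `PinvQk_mulVec_mid`), so that (def_m1) reads
`m_k = (P_k(m)⁻¹Q_k v)[1] / (P_k(m)⁻¹Q_k v)[k+2]` for every `m` (`mqk_eq_div`). The `k = 2, 3` block
matrices were first read off the sympy witness of kit j261466 (`PinvQ`) and agree with the printed
odd/even patterns; they are VERIFIED here against `P_k inv · Q_k` in the kernel. -/

/-- Lemma 2.3 (proof), `k = 0`: `[[M₀,₁, M₀,₂], [M₀,₃, M₀,₄]] = [[1, 1, 0, 0], [0, 0, 1, −1]]` (`= Q₀`,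
as `P₀ = I₂`). [cite: Suzuki2012SelfReciprocal, Lemma 2.3 (proof, display of M_{0,i})] -/
def PinvQ0 : Matrix (Fin 2) (Fin 4) ℝ :=
  !![1, 1, 0, 0;
     0, 0, 1, -1]

/-- Lemma 2.3 (proof), `k = 1`: `[[M₁,₁, M₁,₂], [M₁,₃, M₁,₄]] = [[1,0,1,0,0,0], [0,1,0,0,0,0],
[0,0,0,1,0,−1], [0,1/m₁,0,0,0,0]]`, as printed. [cite: Suzuki2012SelfReciprocal, Lemma 2.3 (proof, display of M_{1,i})] -/
def PinvQ1 (m : ℝ) : Matrix (Fin 4) (Fin 6) ℝ :=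
  !![1, 0, 1, 0, 0, 0;
     0, 1, 0, 0, 0, 0;
     0, 0, 0, 1, 0, -1;
     0, 1 / m, 0, 0, 0, 0]

/-- Lemma 2.3 (proof), `k = 2` (the even pattern at `k = 2`): `M₂,₁ = ½[[2,0,0,2],[0,1,1,0],[0,1,1,0]]`,
`M₂,₂ = (m₂/2)[[0,0,0,0],[0,1,−1,0],[0,−1,1,0]]`, `M₂,₃ = (1/(2m₂))[[0,0,0,0],[0,1,1,0],[0,1,1,0]]`,
`M₂,₄ = ½[[2,0,0,−2],[0,1,−1,0],[0,−1,1,0]]`, assembled as one `6 × 8` matrix.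
[cite: Suzuki2012SelfReciprocal, Lemma 2.3 (proof, M_{k,i} for k ≥ 2 even), k = 2] -/
def PinvQ2 (m : ℝ) : Matrix (Fin 6) (Fin 8) ℝ :=
  !![1, 0, 0, 1, 0, 0, 0, 0;
     0, 1 / 2, 1 / 2, 0, 0, m / 2, -(m / 2), 0;
     0, 1 / 2, 1 / 2, 0, 0, -(m / 2), m / 2, 0;
     0, 0, 0, 0, 1, 0, 0, -1;
     0, 1 / (2 * m), 1 / (2 * m), 0, 0, 1 / 2, -(1 / 2), 0;
     0, 1 / (2 * m), 1 / (2 * m), 0, 0, -(1 / 2), 1 / 2, 0]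

/-- Lemma 2.3 (proof), `k = 3` (the odd pattern at `k = 3`): `M₃,₁ = ½[[2,0,0,0,2],[0,1,0,1,0],
[0,0,2,0,0],[0,1,0,1,0]]`, `M₃,₂ = (m₃/2)[[0,…],[0,1,0,−1,0],[0,0,0,0,0],[0,−1,0,1,0]]`,
`M₃,₃ = (1/(2m₃))[[0,…],[0,1,0,1,0],[0,0,2,0,0],[0,1,0,1,0]]`, `M₃,₄ = ½[[2,0,0,0,−2],[0,1,0,−1,0],
[0,0,0,0,0],[0,−1,0,1,0]]`, assembled as one `8 × 10` matrix.
[cite: Suzuki2012SelfReciprocal, Lemma 2.3 (proof, M_{k,i} for k ≥ 3 odd), k = 3] -/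
def PinvQ3 (m : ℝ) : Matrix (Fin 8) (Fin 10) ℝ :=
  !![1, 0, 0, 0, 1, 0, 0, 0, 0, 0;
     0, 1 / 2, 0, 1 / 2, 0, 0, m / 2, 0, -(m / 2), 0;
     0, 0, 1, 0, 0, 0, 0, 0, 0, 0;
     0, 1 / 2, 0, 1 / 2, 0, 0, -(m / 2), 0, m / 2, 0;
     0, 0, 0, 0, 0, 1, 0, 0, 0, -1;
     0, 1 / (2 * m), 0, 1 / (2 * m), 0, 0, 1 / 2, 0, -(1 / 2), 0;
     0, 0, 1 / m, 0, 0, 0, 0, 0, 0, 0;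
     0, 1 / (2 * m), 0, 1 / (2 * m), 0, 0, -(1 / 2), 0, 1 / 2, 0]

/-- Lemma 2.3 (proof), `k = 0`: `P₀⁻¹Q₀ = [[M₀,₁, M₀,₂], [M₀,₃, M₀,₄]]`. [cite: Suzuki2012SelfReciprocal, Lemma 2.3 (proof: P_k(m_k)⁻¹Q_k = [M_{k,i}]), k = 0] -/
theorem P0inv_mul_Q0 : P0⁻¹ * Q0 = PinvQ0 := by
  rw [inv_P0, Matrix.one_mul]
  ext i j
  fin_cases i <;> fin_cases j <;> simp [Q0, PinvQ0]

/-- Lemma 2.3 (proof), `k = 1`: `P1inv m · Q₁ = [[M₁,₁, M₁,₂], [M₁,₃, M₁,₄]]` (every `m`; with `inv_P1`,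
`P₁(m)⁻¹Q₁` for `m ≠ 0`). [cite: Suzuki2012SelfReciprocal, Lemma 2.3 (proof: P_k(m_k)⁻¹Q_k = [M_{k,i}]), k = 1] -/
theorem P1inv_mul_Q1 (m : ℝ) : P1inv m * Q1 = PinvQ1 m := by
  ext i j
  fin_cases i <;> fin_cases j <;> simp [P1inv, Q1, PinvQ1, Matrix.mul_apply, Fin.sum_univ_succ]

/-- Lemma 2.3 (proof), `k = 2`: `P2inv m · Q₂ = [[M₂,₁, M₂,₂], [M₂,₃, M₂,₄]]` (every `m`).
[cite: Suzuki2012SelfReciprocal, Lemma 2.3 (proof: P_k(m_k)⁻¹Q_k = [M_{k,i}]), k = 2] -/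
theorem P2inv_mul_Q2 (m : ℝ) : P2inv m * Q2 = PinvQ2 m := by
  ext i j
  fin_cases i <;> fin_cases j <;> simp [P2inv, Q2, PinvQ2, Matrix.mul_apply, Fin.sum_univ_succ] <;>
    ring

/-- Lemma 2.3 (proof), `k = 3`: `P3inv m · Q₃ = [[M₃,₁, M₃,₂], [M₃,₃, M₃,₄]]` (every `m`).
[cite: Suzuki2012SelfReciprocal, Lemma 2.3 (proof: P_k(m_k)⁻¹Q_k = [M_{k,i}]), k = 3] -/
theorem P3inv_mul_Q3 (m : ℝ) : P3inv m * Q3 = PinvQ3 m := by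
  ext i j
  fin_cases i <;> fin_cases j <;> simp [P3inv, Q3, PinvQ3, Matrix.mul_apply, Fin.sum_univ_succ] <;>
    ring

/-- `P₁(m)⁻¹Q₁ = [M₁,ᵢ]` with Lean's matrix inverse, `m ≠ 0`. [cite: Suzuki2012SelfReciprocal, Lemma 2.3 (proof: P_k(m_k)⁻¹Q_k = [M_{k,i}]), k = 1, honest inverse] -/
theorem P1_inv_mul_Q1 {m : ℝ} (hm : m ≠ 0) : (P1 m)⁻¹ * Q1 = PinvQ1 m := by
  rw [inv_P1 hm, P1inv_mul_Q1]

/-- `P₂(m)⁻¹Q₂ = [M₂,ᵢ]` with Lean's matrix inverse, `m ≠ 0`. [cite: Suzuki2012SelfReciprocal, Lemma 2.3 (proof: P_k(m_k)⁻¹Q_k = [M_{k,i}]), k = 2, honest inverse] -/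
theorem P2_inv_mul_Q2 {m : ℝ} (hm : m ≠ 0) : (P2 m)⁻¹ * Q2 = PinvQ2 m := by
  rw [inv_P2 hm, P2inv_mul_Q2]

/-- `P₃(m)⁻¹Q₃ = [M₃,ᵢ]` with Lean's matrix inverse, `m ≠ 0`. [cite: Suzuki2012SelfReciprocal, Lemma 2.3 (proof: P_k(m_k)⁻¹Q_k = [M_{k,i}]), k = 3, honest inverse] -/
theorem P3_inv_mul_Q3 {m : ℝ} (hm : m ≠ 0) : (P3 m)⁻¹ * Q3 = PinvQ3 m := by
  rw [inv_P3 hm, P3inv_mul_Q3]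

/-- Lemma 2.3 (the two entries it uses), `k = 1`: `([M₁,ᵢ] v)[1] = v[1] + v[3]` and
`([M₁,ᵢ] v)[3] = v[4] − v[6]` for EVERY `m` (1-based as printed; `0`-based here).
[cite: Suzuki2012SelfReciprocal, Lemma 2.3 (proof, last display), k = 2g − n = 1] -/
theorem PinvQ1_mulVec (m : ℝ) (v : Fin 6 → ℝ) :
    (PinvQ1 m *ᵥ v) 0 = v 0 + v 2 ∧ (PinvQ1 m *ᵥ v) 2 = v 3 - v 5 := by
  constructor <;> simp [PinvQ1, Matrix.mulVec, dotProduct, Fin.sum_univ_succ]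
  ring

/-- Lemma 2.3 (the two entries it uses), `k = 2`: `([M₂,ᵢ] v)[1] = v[1] + v[4]`,
`([M₂,ᵢ] v)[4] = v[5] − v[8]` for every `m`. [cite: Suzuki2012SelfReciprocal, Lemma 2.3 (proof, last display), k = 2g − n = 2] -/
theorem PinvQ2_mulVec (m : ℝ) (v : Fin 8 → ℝ) :
    (PinvQ2 m *ᵥ v) 0 = v 0 + v 3 ∧ (PinvQ2 m *ᵥ v) 3 = v 4 - v 7 := by
  constructor <;> simp [PinvQ2, Matrix.mulVec, dotProduct, Fin.sum_univ_succ]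
  ring

/-- Lemma 2.3 (the two entries it uses), `k = 3`: `([M₃,ᵢ] v)[1] = v[1] + v[5]`,
`([M₃,ᵢ] v)[5] = v[6] − v[10]` for every `m`. [cite: Suzuki2012SelfReciprocal, Lemma 2.3 (proof, last display), k = 2g − n = 3] -/
theorem PinvQ3_mulVec (m : ℝ) (v : Fin 10 → ℝ) :
    (PinvQ3 m *ᵥ v) 0 = v 0 + v 4 ∧ (PinvQ3 m *ᵥ v) 4 = v 5 - v 9 := by
  constructor <;> simp [PinvQ3, Matrix.mulVec, dotProduct, Fin.sum_univ_succ]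
  ring

/-- **Lemma 2.3 for `k = 2g − n ≤ 3`.** The (def_m1) quotient equals the quotient of the first and the
`(k+2)`-nd entries of `P_k(m)⁻¹Q_k v` for EVERY value `m ≠ 0` of the indeterminate:
`(v[1] + v[k+2])/(v[k+3] − v[2k+4]) = (P_k(m)⁻¹Q_k v)[1]/(P_k(m)⁻¹Q_k v)[k+2]`, `k = 1, 2, 3` — «the
right-hand side is independent of the indeterminate element `m`». (For `k = 0` both sides read
`(v[1]+v[2])/(v[3]−v[4])` as `P₀⁻¹Q₀ = Q₀`.) [cite: Suzuki2012SelfReciprocal, Lemma 2.3, k = 2g − n ≤ 3] -/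
theorem mq_eq_div {m : ℝ} (hm : m ≠ 0) :
    (∀ v : Fin 6 → ℝ, mq1 v = ((P1 m)⁻¹ *ᵥ (Q1 *ᵥ v)) 0 / ((P1 m)⁻¹ *ᵥ (Q1 *ᵥ v)) 2) ∧
      (∀ v : Fin 8 → ℝ, mq2 v = ((P2 m)⁻¹ *ᵥ (Q2 *ᵥ v)) 0 / ((P2 m)⁻¹ *ᵥ (Q2 *ᵥ v)) 3) ∧
      (∀ v : Fin 10 → ℝ, mq3 v = ((P3 m)⁻¹ *ᵥ (Q3 *ᵥ v)) 0 / ((P3 m)⁻¹ *ᵥ (Q3 *ᵥ v)) 4) := by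
  refine ⟨fun v => ?_, fun v => ?_, fun v => ?_⟩
  · rw [Matrix.mulVec_mulVec, P1_inv_mul_Q1 hm, (PinvQ1_mulVec m v).1, (PinvQ1_mulVec m v).2, mq1]
  · rw [Matrix.mulVec_mulVec, P2_inv_mul_Q2 hm, (PinvQ2_mulVec m v).1, (PinvQ2_mulVec m v).2, mq2]
  · rw [Matrix.mulVec_mulVec, P3_inv_mul_Q3 hm, (PinvQ3_mulVec m v).1, (PinvQ3_mulVec m v).2, mq3]

end SuzukiSelfReciprocal

end Literature.Algebra.Polynomial
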